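import Literature.Probability.LatticeModels.DiluteLoopModel
import Literature.Probability.RandomPlanarGeometry.SelfAvoidingWalk

/-!
# Objects of the line `symplectic-fermion-anchor` for the crux `SAWLoopFugacityFlow.AvoidanceLimit`
(stmt-CriticalPhenomena-10649; lead prover, crux protocol; skeleton
`Summits/CriticalPhenomena/SAWScalingLimit/Cruxes/AvoidanceLimit/Lines/symplectic-fermion-anchor.lean`,
planner `planner-cruxplan-stmt-CriticalPhenomena-10649-symplectic-fermion-a-0`)

This file only DEFINES the finite lattice objects and the two closed-form functions the line's seven
stubs speak about, so that the stub files `Theorems/SAWLoopFugacityFlowAvoidanceLimit<Stub>.lean` and the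
skeleton can import them; no statement of the line is asserted here (the stub STATEMENTS
`SAWEndpointIdentity`, `Determinantal`, `ExcursionRatio`, `SymplecticWindow`, `FugacityContinuation`,
`VitaliTransport`, `SAWCriticalPoint` stay in the skeleton / stub files).

* `dimerConfigs`, `dimerPF n t x G Λ A` — the self-avoiding walk (source set `A`) dressed by the tree's
  strictly dilute non-crossing loop gas (`DiluteLoopModel ⟨n, 0, x⟩`, collision weight `w = 0`) and by
  DIMERS (doubled edges) of fugacity `t`: `Σ_M (t x²)^{|M|} · Z_{⟨n,0,x⟩}(G, Λ ∖ V(M); A)`; at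
  `(n, t) = (-2, -1)` this is `det(1 - xA)` / `adj(1 - xA)_{ab}` (the line's stub `Determinantal`), at
  `(0, 0)` the SAW generating function (tree: `DiluteLoopModel.partitionFunction_zero_zero_eq_sum_paths`);
  `twoLegDim`, `ratioDim` — the normalised two-leg function and the doubly normalised ratio; `map_*` —
  polynomiality in the parameters (commutation with field homomorphisms, for complex loop fugacity).
* `confinedGraph Ω S δ` — the edges of `Ω_δ = discreteDomainGraph Ω δ` whose closed segment lies in
  `closure S` (same vertex set): a self-avoiding path of `Ω_δ` is a path of the confined graph iff its
  polyline lies in `closure S`, the crux's event `CurveClass.rangeSubset (closure D')`.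
* `Rδ n t x Ω S δ a b` — the route's doubly normalised two-leg boundary ratio `R_δ`: numerator on the
  confined graph, denominator on `Ω_δ`, common volume `meshDomainFinset Ω δ`; over `ℝ` or `ℂ`.
* `halfPlaneSusceptibilityDim`, `chiCoeff`, `xcDim n t` — the intrinsic critical curve of the dressed SAW:
  the radius of convergence (Cauchy–Hadamard form, capped at `1`) of the half-plane two-leg series whose
  `k`-th coefficient `chiCoeff n t k` is read off the box `Λ_k`; SIGN-ROBUST (the weights are signed for
  `n < 0`), and equal to the boundedness threshold of the susceptibilities for nonnegative weights. (The
  planner's skeleton used the boundedness-of-`χ_N` convention of `DiluteLoopModel.criticalFugacity`; the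
  lead reshaped it after the audit recorded in the docstring of `xcDim`.)
* `bExp n = 1 - (3/2π)·arctan √((2+n)/(2-n))` — the Coulomb-gas boundary one-leg exponent along the
  dilute branch (`b(-2) = 1`, `b(0) = 5/8`, `b(1) = 1/2`), in the half-angle form whose complex
  continuation is `Complex.arctan ∘ cpow (1/2)`.
* `adjMat`, `greenEntry`, `greenRatio` — the killed simple-random-walk Green's function
  `((1 - A/4)⁻¹)_{ab}` of a finite piece of `ℤ²` and the confined/unconfined ratio (the `n = -2` anchor in
  potential-theory language).

Sources: B. Nienhuis, Phys. Rev. Lett. 49 (1982) [Nienhuis1982]; H. Blöte, B. Nienhuis, J. Phys. A 22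
(1989) [doi:10.1088/0305-4470/22/9/028]; J. Cardy, *SLE for theoretical physicists*, Ann. Phys. 318
(2005) §5.3 [Cardy2005SLE] (the exponent `b = (6-κ)/(2κ)`, `n = -2cos(4π/κ)`); G. Lawler, *Topics in
loop measures and the loop-erased walk*, Probab. Surveys 15 (2018) Prop. 3.1 [Lawler2018] (adjugate /
Green's function); N. Madras, G. Slade, *The Self-Avoiding Walk* (1993) §3.1 [MadrasSlade1993]
(half-space susceptibility and its critical point). Deliberately NOT here: any statement or theorem of the
line.
-/

noncomputable section

open scoped BigOperators Topology symmDiff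
open Filter Finset
open Literature.Probability.RandomPlanarGeometry Literature.Probability.LatticeModels

namespace Summit.CriticalPhenomena.SAWScalingLimit.Theorems.AvoidanceLimit.Anchor

/-! ## The loop + dimer dressed SAW on finite pieces of `ℤ²` (built on the tree's `DiluteLoopModel` at `w = 0`) -/

section Model

variable {K : Type*} [Field K]

/-- The vertices of `Λ` covered by the edge set `M`. -/
def covered (Λ : Finset (Site 2)) (M : Finset (Sym2 (Site 2))) : Finset (Site 2) :=
  open scoped Classical in Λ.filter fun v => ∃ e ∈ M, v ∈ e

/-- DIMER configurations: sets `M` of pairwise vertex-disjoint edges of `G` inside `Λ` (doubled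
edges = the 2-cycles of the determinant expansion) avoiding the source set `A`. -/
def dimerConfigs (G : SimpleGraph (Site 2)) [G.LocallyFinite] (Λ A : Finset (Site 2)) :
    Finset (Finset (Sym2 (Site 2))) :=
  open scoped Classical in
  (edgesIn G Λ).powerset.filter fun M =>
    (∀ v ∈ Λ, #(M.filter fun e => v ∈ e) ≤ 1) ∧ ∀ v ∈ A, ∀ e ∈ M, v ∉ e

/-- **`Z_{n,t,x}(G, Λ; A)`** — the partition function of the SAW (source set `A`, `|A| ∈ {0,2}`)
dressed by a gas of self- and mutually-avoiding simple LOOPS of fugacity `n` and DIMERS (doubled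
edges) of fugacity `t`, edge fugacity `x`, everything pairwise vertex-disjoint:
`Σ_M (t x²)^{|M|} · Z^{tree}_{⟨n, 0, x⟩}(G, Λ ∖ V(M); A)`, the inner factor being the tree's dilute
non-crossing loop model at collision weight `w = 0` (strictly dilute) on the vertices not covered by
dimers. At `(n, t) = (-2, -1)`: `det(1 - xA)` / `adj(1 - xA)_{ab}` (`Determinantal`); at `t = 0`:
the tree's `⟨n, 0, x⟩.partitionFunction`; at `(0, 0)`: the SAW generating function. -/
def dimerPF (n t x : K) (G : SimpleGraph (Site 2)) [G.LocallyFinite] (Λ A : Finset (Site 2)) : K :=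
  ∑ M ∈ dimerConfigs G Λ A,
    (t * x ^ 2) ^ #M * (⟨n, 0, x⟩ : DiluteLoopModel K).partitionFunction G (Λ \ covered Λ M) A

/-- The normalised two-leg function `Z(G, Λ; {a} ∆ {b}) / Z(G, Λ; ∅)` of the dressed SAW. -/
def twoLegDim (n t x : K) (G : SimpleGraph (Site 2)) [G.LocallyFinite] (Λ : Finset (Site 2))
    (a b : Site 2) : K :=
  dimerPF n t x G Λ ({a} ∆ {b}) / dimerPF n t x G Λ ∅

/-- The doubly normalised two-leg RATIO `twoLeg(G', Λ') / twoLeg(G, Λ)` (the route's `R`). -/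
def ratioDim (n t x : K) (G' : SimpleGraph (Site 2)) [G'.LocallyFinite] (Λ' : Finset (Site 2))
    (G : SimpleGraph (Site 2)) [G.LocallyFinite] (Λ : Finset (Site 2)) (a b : Site 2) : K :=
  twoLegDim n t x G' Λ' a b / twoLegDim n t x G Λ a b

/-- `Z` is a polynomial expression in `(n, t, x)`: it commutes with field homomorphisms. -/
theorem map_dimerPF {K' : Type*} [Field K'] (f : K →+* K') (n t x : K) (G : SimpleGraph (Site 2))
    [G.LocallyFinite] (Λ A : Finset (Site 2)) :
    f (dimerPF n t x G Λ A) = dimerPF (f n) (f t) (f x) G Λ A := by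
  simp only [dimerPF, map_sum, map_mul, map_pow, DiluteLoopModel.map_partitionFunction,
    DiluteLoopModel.map, map_zero]

/-- The normalised two-leg function commutes with field homomorphisms. [folklore] -/
theorem map_twoLegDim {K' : Type*} [Field K'] (f : K →+* K') (n t x : K) (G : SimpleGraph (Site 2))
    [G.LocallyFinite] (Λ : Finset (Site 2)) (a b : Site 2) :
    f (twoLegDim n t x G Λ a b) = twoLegDim (f n) (f t) (f x) G Λ a b := by
  rw [twoLegDim, twoLegDim, map_div₀, map_dimerPF, map_dimerPF]

/-- The doubly normalised ratio commutes with field homomorphisms. [folklore] -/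
theorem map_ratioDim {K' : Type*} [Field K'] (f : K →+* K') (n t x : K) (G' : SimpleGraph (Site 2))
    [G'.LocallyFinite] (Λ' : Finset (Site 2)) (G : SimpleGraph (Site 2)) [G.LocallyFinite]
    (Λ : Finset (Site 2)) (a b : Site 2) :
    f (ratioDim n t x G' Λ' G Λ a b) = ratioDim (f n) (f t) (f x) G' Λ' G Λ a b := by
  rw [ratioDim, ratioDim, map_div₀, map_twoLegDim, map_twoLegDim]

end Model

/-! ## The confined graph, the route's ratio `R_δ`, the intrinsic critical curve, the exponent -/

/-- **The CONFINED graph**: the edges of `Ω_δ = discreteDomainGraph Ω δ` whose closed segment lies in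
`closure S` (same vertex set). A self-avoiding path of `Ω_δ` is a path of `confinedGraph Ω S δ` iff
its polyline lies in `closure S` — exactly the crux's event `rangeSubset (closure D')`. -/
def confinedGraph (Ω S : Set ℂ) (δ : ℝ) : SimpleGraph (Site 2) :=
  SimpleGraph.fromRel fun x y =>
    (discreteDomainGraph Ω δ).Adj x y ∧ segment ℝ (meshPoint δ x) (meshPoint δ y) ⊆ closure S

/-- The confined graph is a subgraph of `Ω_δ`. [folklore] -/
theorem confinedGraph_le (Ω S : Set ℂ) (δ : ℝ) : confinedGraph Ω S δ ≤ discreteDomainGraph Ω δ := by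
  intro x y h
  rw [confinedGraph, SimpleGraph.fromRel_adj] at h
  rcases h.2 with h' | h'
  · exact h'.1
  · exact h'.1.symm

/-- The confined graph is a subgraph of `ℤ²` (via `Ω_δ ≤ meshGraph ≤ ℤ²`; the middle fact is the tree's
`SAW.discreteDomainGraph_le_zdGraph` / `discreteDomainGraph_le_meshGraph`). [folklore] -/
theorem confinedGraph_le_zdGraph (Ω S : Set ℂ) (δ : ℝ) : confinedGraph Ω S δ ≤ zdGraph 2 :=
  (confinedGraph_le Ω S δ).trans ((discreteDomainGraph_le_meshGraph Ω δ).trans (meshGraph_le_zdGraph Ω δ))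

/-- The confined graph is locally finite (a subgraph of `ℤ²`). -/
instance instLocallyFiniteConfinedGraph (Ω S : Set ℂ) (δ : ℝ) : (confinedGraph Ω S δ).LocallyFinite :=
  fun x => (((zdGraph 2).neighborSet x).toFinite.subset
    (SimpleGraph.neighborSet_mono (confinedGraph_le_zdGraph Ω S δ) x)).fintype

/-- **`R_δ(n, t, x; Ω, S)`** — the doubly normalised two-leg boundary ratio of the dressed SAW between
the lattice points `a, b`: numerator on the confined graph (configurations inside `closure S`),
denominator on `Ω_δ`, common volume `meshDomainFinset Ω δ`. Over `K = ℝ` (real fugacities) or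
`K = ℂ` (complex loop fugacity, for analyticity). -/
def Rδ {K : Type*} [Field K] (n t x : K) (Ω S : Set ℂ) (δ : ℝ) (a b : Site 2) : K :=
  ratioDim n t x (confinedGraph Ω S δ) (meshDomainFinset Ω δ) (discreteDomainGraph Ω δ)
    (meshDomainFinset Ω δ) a b

/-- `R_δ` commutes with field homomorphisms (polynomiality in `(n, t, x)`). [folklore] -/
theorem map_Rδ {K K' : Type*} [Field K] [Field K'] (f : K →+* K') (n t x : K) (Ω S : Set ℂ) (δ : ℝ)
    (a b : Site 2) : f (Rδ n t x Ω S δ a b) = Rδ (f n) (f t) (f x) Ω S δ a b := by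
  rw [Rδ, Rδ, map_ratioDim]

/-- Real parameters: the complex ratio is the real ratio. -/
theorem Rδ_ofReal (n t x : ℝ) (Ω S : Set ℂ) (δ : ℝ) (a b : Site 2) :
    Rδ (n : ℂ) (t : ℂ) (x : ℂ) Ω S δ a b = ((Rδ n t x Ω S δ a b : ℝ) : ℂ) := by
  have h := map_Rδ Complex.ofRealHom n t x Ω S δ a b
  simpa using h.symm

/-- The half-plane two-leg susceptibility `χ_N(n, t, x) = Σ_{b ∈ Λ_N} twoLeg(ℤ², Λ_N; 0, b)` of the
dressed SAW, `Λ_N = [-N, N] × [0, N]` (tree: `DiluteLoopModel.halfPlaneBox`). -/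
def halfPlaneSusceptibilityDim (n t x : ℝ) (N : ℕ) : ℝ :=
  ∑ b ∈ DiluteLoopModel.halfPlaneBox N, twoLegDim n t x (zdGraph 2) (DiluteLoopModel.halfPlaneBox N) 0 b

/-- **Taylor coefficients of the half-plane two-leg susceptibility.** `chiCoeff n t k` is the `k`-th
Taylor coefficient at `x = 0` of `x ↦ χ_k(n, t, x)` (the susceptibility of the box `Λ_k`, a rational
function of `x` with all denominators `= 1` at `x = 0`). Using the box `Λ_k` for the `k`-th coefficient
makes it the coefficient of the infinite-volume (half-plane) series: a configuration contributing to
order `x^k` in `Z(Λ_N; {0} ∆ {b})/Z(Λ_N; ∅)` is a walk from `0` of length `≤ k` together with clusters of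
loops/dimers attached to it (detached ones cancel in the ratio), hence lies in `Λ_k`, for every `N ≥ k`.
At `(n, t) = (0, 0)` it is the number of `k`-step self-avoiding walks from `0` in the closed upper
half-plane; at `(-2, -1)` the number of `k`-step nearest-neighbour walks from `0` in the closed upper
half-plane (`(1 - xA)⁻¹ = Σ x^k A^k`). [cite: MadrasSlade1993, §1.2–§1.3 (two-point function and susceptibility as generating functions)] -/
def chiCoeff (n t : ℝ) (k : ℕ) : ℝ :=
  iteratedDeriv k (fun x : ℝ => halfPlaneSusceptibilityDim n t x k) 0 / k.factorial

/-- **The intrinsic critical curve `x_c(n, t)`** of the dressed SAW (real parameters, possibly SIGNED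
weights): the radius of convergence of the half-plane two-leg series `Σ_k chiCoeff n t k · x^k`, in
Cauchy–Hadamard form — the supremum of the `r ∈ [0, 1]` at which `|chiCoeff n t k| r^k` stays bounded —
capped at `1` so that the `sSup` is over a bounded set (every critical value of the family is expected in
`[1/4, 1/μ]`). This is SIGN-ROBUST: for nonnegative weights (`n, t ≥ 0`) it is the boundedness threshold
of the monotone susceptibilities `χ_N(x)` (Pringsheim), e.g. `x_c(0, 0) = 1/μ(ℤ²)` (stub
`SAWCriticalPoint`: `b_k ≤ chiCoeff 0 0 k ≤ c_k`, Hammersley–Welsh); for signed weights the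
boundedness-of-`χ_N` convention of the tree's `DiluteLoopModel.criticalFugacity` is NOT usable (lead's
audit F0, 2026-08-16: at `(n, t) = (-2, -1)` the signed resolvent sums `Σ_b (1 - xA_N)⁻¹_{0b}` for
`x ∈ (1/4, 1]` are erratic in `N` with near-resonant spikes and no monotonicity, so the set of "bounded"
fugacities above `1/4` is a Diophantine accident), while the series has nonnegative coefficients there and
radius exactly `1/4`. Expected: `x_c(-2, -1) = 1/4`, `x_c(0, 0) = 1/μ`. [cite: MadrasSlade1993, §1.2–§1.3] -/
def xcDim (n t : ℝ) : ℝ :=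
  sSup {r : ℝ | 0 ≤ r ∧ r ≤ 1 ∧ BddAbove (Set.range fun k : ℕ => |chiCoeff n t k| * r ^ k)}

/-- **The Coulomb-gas boundary one-leg exponent along the dilute branch**, as a function of the loop
fugacity: `b = (6 - κ)/(2κ)`, `n = -2cos(4π/κ)` with `4π/κ = 2π - arccos(-n/2) ∈ [π, 2π]`, i.e.
`b(n) = 1 - (3/4π)·arccos(-n/2) = 1 - (3/2π)·arctan √((2+n)/(2-n))` (half-angle form, chosen so
that the complex continuation is Mathlib's `Complex.arctan ∘ cpow (1/2)`, holomorphic on the strip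
`-2 < Re z < 2`, and so that the square-root onset at the anchor is manifest):
`b(-2) = 1` (excursion / LERW, `κ = 2`), `b(0) = 5/8` (SAW, `κ = 8/3`), `b(1) = 1/2` (Ising,
`κ = 3`); near the anchor `b(n) - 1 = -(3/2π)·√(n+2)/2 + O((n+2)^{3/2}) = -(3/4π)√(n+2) + …`
(the anchor is a branch point, triage r1-3). Junk (`= 1`) for `n < -2`. -/
def bExp (n : ℝ) : ℝ := 1 - 3 * Real.arctan (Real.sqrt ((2 + n) / (2 - n))) / (2 * Real.pi)

/-- `b(-2) = 1`: the excursion / free-symplectic-fermion value at the anchor. [cite: Cardy2005SLE, §5.3] -/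
theorem bExp_neg_two : bExp (-2) = 1 := by
  norm_num [bExp, Real.arctan_zero]

/-- `b(0) = 5/8`: the value that `AvoidanceLimit` asserts (cf. `avoidanceLimit_not_exp`: no other
exponent is compatible with the crux). -/
theorem bExp_zero : bExp 0 = 5 / 8 := by
  have hπ : Real.pi ≠ 0 := Real.pi_ne_zero
  have h : Real.sqrt ((2 + 0) / (2 - 0) : ℝ) = 1 := by norm_num
  rw [bExp, h, Real.arctan_one]
  field_simp
  ring

/-- `b(1) = 1/2`: the route's Ising anchor value (`IsingBoundaryRatio`) sits on the same curve. -/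
theorem bExp_one : bExp 1 = 1 / 2 := by
  have hπ : Real.pi ≠ 0 := Real.pi_ne_zero
  have h : Real.sqrt ((2 + 1) / (2 - 1) : ℝ) = Real.sqrt 3 := by norm_num
  rw [bExp, h, Real.arctan_sqrt_three]
  field_simp
  ring

/-! ## Green's-function language for the anchor -/

/-- The adjacency matrix of `H` restricted to the volume `Λ`. -/
def adjMat (H : SimpleGraph (Site 2)) (Λ : Finset (Site 2)) : Matrix Λ Λ ℝ :=
  open scoped Classical in fun u v => if H.Adj u.1 v.1 then 1 else 0

/-- The simple-random-walk Green's function of `H|_Λ` between `a` and `b`: the entry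
`((1 - A/4)⁻¹)_{ab} = Σ_{walks a → b of H|_Λ} 4^{-|w|}` (walk on `ℤ²` killed when it attempts a step
that is not an edge of `H|_Λ`; Neumann series, spectral radius `< 4` on finite pieces of `ℤ²`);
junk `0` if `a ∉ Λ` or `b ∉ Λ`. -/
def greenEntry (H : SimpleGraph (Site 2)) (Λ : Finset (Site 2)) (a b : Site 2) : ℝ :=
  if h : a ∈ Λ ∧ b ∈ Λ then ((1 : Matrix Λ Λ ℝ) - (4 : ℝ)⁻¹ • adjMat H Λ)⁻¹ ⟨a, h.1⟩ ⟨b, h.2⟩ else 0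

/-- The ratio of Green's functions "walk confined to `closure S`" / "walk in `Ω_δ`" between `a, b`. -/
def greenRatio (Ω S : Set ℂ) (δ : ℝ) (a b : Site 2) : ℝ :=
  greenEntry (confinedGraph Ω S δ) (meshDomainFinset Ω δ) a b /
    greenEntry (discreteDomainGraph Ω δ) (meshDomainFinset Ω δ) a b

end Summit.CriticalPhenomena.SAWScalingLimit.Theorems.AvoidanceLimit.Anchor

end
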